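import Summits.CriticalPhenomena.Ising3DConformalLimit.Theses.OctantEntropy
import Literature.Probability.LatticeModels.BoxGraphs

/-!
# Birth skeleton — crux `QuenchedMassExponent` (item stmt-CriticalPhenomena-11352), route `OctantEntropy`

Skeleton registrar `planner-skel-stmt-CriticalPhenomena-11352-0` (2026-08-17), BC3 of
`run/shared/lean/lens3/_common/BC.md`. Published as `Cruxes/QuenchedMassExponent/Lines/birth.lean`.

## The crux

`QuenchedMassExponent` (rank 2 of route-CriticalPhenomena-OctantEntropy): with
`a_K := limsup_{L→∞} E_{K,L}[log₂ #(C_{n₁+n₂}(0) ∩ [−2^K,2^K)³)]` — the QUENCHED log-mass of the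
cluster of the origin of the critical sourced double current on the free box graph of `Λ_L ⊂ ℤ³`
(sources `{0, 2^(K+1)e₁}` for `n₁`, `∅` for `n₂`) inside the dyadic window of depth `K` — there is
`D` with `a_K / K → D`.  Below `aK K` is VERBATIM the inner term of the route decl, so
`QuenchedMassExponent ↔ ∃ D, Tendsto (fun K => aK K / K) atTop (nhds D)` holds by `Iff.rfl`
(`quenchedMassExponent_iff_aK`).

## The line: Fekete across dyadic scales ("sub-additivity converts the exponent into ONE inequality")

The route's own rationale compares crux (Q) to the connective constant: existence of a limit of
log-ratios is converted into one approximate inequality between scales.  This skeleton makes that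
literal.  By Fekete's lemma (`Subadditive.tendsto_lim`, affine form proved here as
`exists_tendsto_div_of_quasiSubadditive`) it suffices to know

* `stub_aprioriWindow` — the a-priori window `0 ≤ a_K ≤ 3(K+1)` for every `K` (the window has
  `2^(3(K+1))` sites and the mass is `≥ 1` because the origin is joined to itself; the sourced
  critical double-current measure has total mass `≤ 1`; `limsup` of a sequence confined to
  `[0, 3(K+1)]` stays there).  Provable now (M-sized: normalisation of `doubleCurrentMeasure` via
  `hasSum_pairWeight`, integral bounds, `limsup` bounds); it is what makes Fekete's limit FINITE and
  is needed in BOTH branches below (lower bound for the sub-additive branch, upper bound for the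
  super-additive one).
* `stub_quasiAdditive` — THE ENGINE (research): ONE-SIDED quasi-additivity of the quenched
  log-mass across dyadic scales, `a_(K+M) ≤ a_K + a_M + C` for all `K, M` (sub-additive branch) OR
  `a_K + a_M ≤ a_(K+M) + C` for all `K, M` (super-additive branch), for some constant `C`.
  Mechanism: cover the depth-`(K+M)` window by the `8^M` blocks of side `2^(K+1)`; the cluster of
  the origin meets `N` blocks and carries in each met block a scale-`K` cluster piece, so
  `log₂ mass_(K+M) ≈ log₂ N + log₂(block mass)`; the coarse count `N` is a scale-`M` mass of the
  block-coarse-grained cluster (scale covariance of the critical sourced current = the card's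
  zoom-ergodicity, read at two scales only) and relocating the far source from `2^(K+1)e₁` to
  `2^(K+M+1)e₁` costs `O(1)` in quenched log-mass (mixing across scales, ADC21 Thm 6.4-type input;
  first-moment side exact by the PROVED switching identity `SwitchingFirstMoment`, item 11355).
  It is implied by the sharp scaling form `a_K = D·K + O(1)` and — unlike convergence of the
  increments `a_(K+1) − a_K` — it TOLERATES a bounded log-periodic modulation of `a_K − D·K`
  (an RG limit cycle), which the route header names as the point of stating (Q) as a Cesàro-type
  limit.  Either branch suffices; the sub-additive (upper-bound) branch is the expected proof
  (first-moment / union bounds go upward; the lower tail of the mass is crux MonofractalMass'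
  business), the super-additive branch is kept so that a prover who finds the FKG-type lower
  comparison easier is not locked out.  Why it might fail: the defect `a_(K+M) − a_K − a_M` could
  drift like `o(K)` unboundedly in both directions (e.g. `√K` corrections to the quenched average
  from a heavy lower tail of the mass), in which case (Q) may still hold but not via Fekete.

Entropy reading (the card's dictionary, now in tree): by the exact chain rule
`Literature.Dynamics.FractalDistributions.OctantSplittingEntropy.sum_range_meanLevelEntropy_indicator`
(`log₂ #S = ∑_{k ≤ K} h_k(𝟙_S)` along the mass-driven octree chain of `OctreeCPChain.lean`),
`a_K` is the expected total octant-splitting entropy of the depth-`K` source cluster, and the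
sub-additive branch of `stub_quasiAdditive` reads: the top `M` levels of the depth-`(K+M)` chain
carry at most `a_M + O(1)` bits and the bottom `K+1` levels at most `a_K + O(1)` bits in the mean —
"entropy per level depends on the level, not on the total depth", i.e. zoom-stationarity of the
critical cluster read at two depths (the CP-chain ergodic theorem is NOT needed for Fekete, only
this two-depth comparison).

`QuenchedMassExponent_of : Registered.stub_aprioriWindow → Registered.stub_quasiAdditive → QuenchedMassExponent`
(the `Registered.*` abbrevs are the stub statements verbatim, keyed by stub name for the audit) is sorry-free
(via `tendsto_div_of_window_of_quasiAdditive`: two Fekete branches; the super-additive branch runs Fekete on `−a_K` with the lower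
bound `−a_K/K ≥ −6` for `K ≥ 1` from the window's upper edge) and concludes the crux BY NAME.

Disproof used: none — `ledger crux ls stmt-CriticalPhenomena-11352` shows no `Disproof.lean`
(no `_false_without_` theorem, no landed `Negative/` lemma) at registration time; item evidence read:
DefeqEvidence.lean (planner rrepair-g3: decl ↔ rev-2 item by `Iff.rfl`), Evidence11352.lean
(refuter crux-attack: `quenchedMassExponent_iff`, `aK_mem_Icc : 0 ≤ a_K ≤ 3(K+1)` proved there —
i.e. `stub_aprioriWindow` has a recorded proof sketch; `aK_div_mem_Icc`).
-/

namespace Summit.CriticalPhenomena.Ising3DConformalLimit.Cruxes.QuenchedMassExponent.Birth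

open scoped BigOperators Topology Manifold Classical MeasureTheory ProbabilityTheory Matrix InnerProductSpace ComplexConjugate ContinuousMap
open Filter Set Function TopologicalSpace MeasureTheory

/-- The QUENCHED log-mass at octree depth `K`:
`a_K = limsup_{L→∞} E_{K,L}[log₂ #(C_{n₁+n₂}(0) ∩ [−2^K,2^K)³)]`, VERBATIM the inner term of the
route decl `OctantEntropy.QuenchedMassExponent` (free box graph of `Λ_L` inlined as a
`SimpleGraph.mk` literal on `↥(box 3 (L+1))`; sources `{0, 2^(K+1)e₁}` and `∅`; `β = β_c(3)`). -/
noncomputable def aK (K : ℕ) : ℝ :=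
  Filter.limsup (fun L : ℕ => ∫ p, Real.logb 2 ((Finset.univ.filter fun u : ↥(Literature.Probability.LatticeModels.box 3 (L + 1)) => (∀ i, -(2 ^ K : ℤ) ≤ (u : Literature.Probability.LatticeModels.Site 3) i ∧ (u : Literature.Probability.LatticeModels.Site 3) i < 2 ^ K) ∧ p ∈ Literature.Probability.LatticeModels.tracedConn ((SimpleGraph.mk (fun a b : ↥(Literature.Probability.LatticeModels.box 3 (L + 1)) => (Literature.Probability.LatticeModels.zdGraph 3).Adj a.1 b.1 ∧ (a : Literature.Probability.LatticeModels.Site 3) ∈ Literature.Probability.LatticeModels.box 3 L ∧ (b : Literature.Probability.LatticeModels.Site 3) ∈ Literature.Probability.LatticeModels.box 3 L) ⟨fun _ _ h => ⟨h.1.symm, h.2.2, h.2.1⟩⟩ ⟨fun _ h => h.1.ne rfl⟩)) ⟨0, Literature.Probability.LatticeModels.zero_mem_box 3 (L + 1)⟩ u).card : ℝ) ∂(Literature.Probability.LatticeModels.doubleCurrentMeasure ((SimpleGraph.mk (fun a b : ↥(Literature.Probability.LatticeModels.box 3 (L + 1)) => (Literature.Probability.LatticeModels.zdGraph 3).Adj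 a.1 b.1 ∧ (a : Literature.Probability.LatticeModels.Site 3) ∈ Literature.Probability.LatticeModels.box 3 L ∧ (b : Literature.Probability.LatticeModels.Site 3) ∈ Literature.Probability.LatticeModels.box 3 L) ⟨fun _ _ h => ⟨h.1.symm, h.2.2, h.2.1⟩⟩ ⟨fun _ h => h.1.ne rfl⟩)) (Literature.Probability.LatticeModels.criticalBeta 3) (Finset.univ.filter fun v : ↥(Literature.Probability.LatticeModels.box 3 (L + 1)) => (v : Literature.Probability.LatticeModels.Site 3) = 0 ∨ (v : Literature.Probability.LatticeModels.Site 3) = Pi.single 0 (2 ^ (K + 1))) ∅)) Filter.atTop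

/-- Read-back: the crux is literally "`a_K / K` converges". -/
theorem quenchedMassExponent_iff_aK :
    Summit.CriticalPhenomena.Ising3DConformalLimit.Theses.OctantEntropy.QuenchedMassExponent ↔
      ∃ D : ℝ, Filter.Tendsto (fun K : ℕ => aK K / (K : ℝ)) Filter.atTop (nhds D) :=
  Iff.rfl

/-- Read-back for provers, in the import-light `BoxGraphs.free 3 L` vocabulary (the inlined graph
literal of the route decl IS `BoxGraphs.free 3 L` unfolded; `freeBoxGraph 3 L` of
`DoubleCurrents.lean` unfolds to the same). -/
theorem aK_eq (K : ℕ) :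
    aK K = Filter.limsup (fun L : ℕ => ∫ p, Real.logb 2 ((Finset.univ.filter fun u : Literature.Probability.LatticeModels.BoxGraphs.Vertex 3 L => (∀ i, -(2 ^ K : ℤ) ≤ (u : Literature.Probability.LatticeModels.Site 3) i ∧ (u : Literature.Probability.LatticeModels.Site 3) i < 2 ^ K) ∧ p ∈ Literature.Probability.LatticeModels.tracedConn (Literature.Probability.LatticeModels.BoxGraphs.free 3 L) ⟨0, Literature.Probability.LatticeModels.zero_mem_box 3 (L + 1)⟩ u).card : ℝ) ∂(Literature.Probability.LatticeModels.doubleCurrentMeasure (Literature.Probability.LatticeModels.BoxGraphs.free 3 L) (Literature.Probability.LatticeModels.criticalBeta 3) (Finset.univ.filter fun v : Literature.Probability.LatticeModels.BoxGraphs.Vertex 3 L => (v : Literature.Probability.LatticeModels.Site 3) = 0 ∨ (v : Literature.Probability.LatticeModels.Site 3) = Pi.single 0 (2 ^ (K + 1))) ∅)) Filter.atTop :=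
  rfl

/-! ## Registered stubs -/

/-- **Stub W (a-priori window; provable now, M-sized).** `0 ≤ a_K ≤ 3(K+1)` for every `K`:
the window `[−2^K,2^K)³` has `2^(3(K+1))` sites, the mass is `≥ 1` (the origin is joined to
itself, so no `logb 2 0` junk), the sourced critical double-current measure has total mass `≤ 1`
(`= 1` once `2^(K+1) ≤ L`, `= 0` before), and `limsup_L` of a sequence confined to `[0, 3(K+1)]`
lies in `[0, 3(K+1)]`.  Both edges are load-bearing in `QuenchedMassExponent_of`. -/
theorem stub_aprioriWindow : ∀ K : ℕ, 0 ≤ aK K ∧ aK K ≤ 3 * ((K : ℝ) + 1) := by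
  sorry

/-- **Stub E (THE ENGINE: one-sided quasi-additivity across dyadic scales; research).**
For some constant `C`, either `a_(K+M) ≤ a_K + a_M + C` for all `K, M` (coarse-graining /
first-moment direction) or `a_K + a_M ≤ a_(K+M) + C` for all `K, M` (FKG / gluing direction).
Implied by the sharp scaling form `a_K = D·K + O(1)` (bounded, possibly log-periodic, defect);
strictly stronger than the crux only in forbidding unbounded `o(K)` drifts of the defect. -/
theorem stub_quasiAdditive : (∃ C : ℝ, ∀ K M : ℕ, aK (K + M) ≤ aK K + aK M + C) ∨ (∃ C : ℝ, ∀ K M : ℕ, aK K + aK M ≤ aK (K + M) + C) := by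
  sorry

/-! ## Name-keyed aliases of the stub STATEMENTS (the hypotheses of the composition)

The skeleton audit (`#h21_check_skeleton`) admits as hypotheses of `QuenchedMassExponent_of` only
registered obligations BY NAME; `Registered.stub_<name>` is the reducible alias of the statement of
`stub_<name>` (verbatim the same text), so `QuenchedMassExponent_of : Registered.stub_aprioriWindow →
Registered.stub_quasiAdditive → QuenchedMassExponent` is literally "stub signatures ⟹ crux". -/
namespace Registered

/-- Alias (reducible) of the statement of `stub_aprioriWindow`. -/
abbrev stub_aprioriWindow : Prop := ∀ K : ℕ, 0 ≤ aK K ∧ aK K ≤ 3 * ((K : ℝ) + 1)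

/-- Alias (reducible) of the statement of `stub_quasiAdditive`. -/
abbrev stub_quasiAdditive : Prop := (∃ C : ℝ, ∀ K M : ℕ, aK (K + M) ≤ aK K + aK M + C) ∨ (∃ C : ℝ, ∀ K M : ℕ, aK K + aK M ≤ aK (K + M) + C)

end Registered

/-- The aliases ARE the stub statements (both `Iff.rfl`). -/
theorem registered_stub_aprioriWindow_iff : Registered.stub_aprioriWindow ↔ (∀ K : ℕ, 0 ≤ aK K ∧ aK K ≤ 3 * ((K : ℝ) + 1)) := Iff.rfl
theorem registered_stub_quasiAdditive_iff : Registered.stub_quasiAdditive ↔ ((∃ C : ℝ, ∀ K M : ℕ, aK (K + M) ≤ aK K + aK M + C) ∨ (∃ C : ℝ, ∀ K M : ℕ, aK K + aK M ≤ aK (K + M) + C)) := Iff.rfl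

/-! ## Fekete, affine one-sided form (sorry-free glue) -/

/-- Fekete's lemma with an additive defect: if `a (m+n) ≤ a m + a n + C` for all `m n` and
`a n / n` is bounded below on `n ≥ 1`, then `a n / n` converges (to a real number). -/
theorem exists_tendsto_div_of_quasiSubadditive (a : ℕ → ℝ) (C B : ℝ)
    (hsub : ∀ m n : ℕ, a (m + n) ≤ a m + a n + C) (hbdd : ∀ n : ℕ, 1 ≤ n → B ≤ a n / (n : ℝ)) :
    ∃ D : ℝ, Filter.Tendsto (fun n : ℕ => a n / (n : ℝ)) Filter.atTop (nhds D) := by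
  obtain ⟨C', hC'0, hsub'⟩ : ∃ C' : ℝ, 0 ≤ C' ∧ ∀ m n : ℕ, a (m + n) ≤ a m + a n + C' :=
    ⟨max C 0, le_max_right _ _, fun m n => (hsub m n).trans (by linarith [le_max_left C 0])⟩
  have hS : Subadditive (fun n : ℕ => a n + C') := fun m n => by
    show a (m + n) + C' ≤ (a m + C') + (a n + C')
    linarith [hsub' m n]
  have hB : BddBelow (Set.range fun n : ℕ => (a n + C') / (n : ℝ)) := by
    refine ⟨min B 0, ?_⟩
    rintro _ ⟨n, rfl⟩
    show min B 0 ≤ (a n + C') / (n : ℝ)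
    rcases Nat.eq_zero_or_pos n with rfl | hn
    · simp
    · have h1 : B ≤ a n / (n : ℝ) := hbdd n hn
      have h2 : (0 : ℝ) ≤ C' / (n : ℝ) := div_nonneg hC'0 (Nat.cast_nonneg n)
      have h3 : (a n + C') / (n : ℝ) = a n / (n : ℝ) + C' / (n : ℝ) := add_div _ _ _
      rw [h3]
      exact (min_le_left _ _).trans (by linarith)
  refine ⟨hS.lim, ?_⟩
  have h1 : Filter.Tendsto (fun n : ℕ => (a n + C') / (n : ℝ)) Filter.atTop (nhds hS.lim) :=
    hS.tendsto_lim hB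
  have h2 : Filter.Tendsto (fun n : ℕ => C' / (n : ℝ)) Filter.atTop (nhds 0) :=
    tendsto_const_div_atTop_nhds_zero_nat C'
  have h3 := h1.sub h2
  rw [sub_zero] at h3
  refine h3.congr' (Filter.Eventually.of_forall fun n => ?_)
  show (a n + C') / (n : ℝ) - C' / (n : ℝ) = a n / (n : ℝ)
  ring

/-! ## The composition: stub signatures ⟹ `a_K / K` converges (sorry-free) -/

/-- Window + one-sided quasi-additivity ⟹ `a_K / K` converges: two Fekete branches. -/
theorem tendsto_div_of_window_of_quasiAdditive
    (hW : ∀ K : ℕ, 0 ≤ aK K ∧ aK K ≤ 3 * ((K : ℝ) + 1))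
    (hQA : (∃ C : ℝ, ∀ K M : ℕ, aK (K + M) ≤ aK K + aK M + C) ∨ (∃ C : ℝ, ∀ K M : ℕ, aK K + aK M ≤ aK (K + M) + C)) :
    ∃ D : ℝ, Filter.Tendsto (fun K : ℕ => aK K / (K : ℝ)) Filter.atTop (nhds D) := by
  rcases hQA with ⟨C, hC⟩ | ⟨C, hC⟩
  · -- sub-additive branch: Fekete on `a_K + C`, lower bound `a_K / K ≥ 0` from the window
    exact exists_tendsto_div_of_quasiSubadditive aK C 0 hC
      (fun n _ => div_nonneg (hW n).1 (Nat.cast_nonneg n))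
  · -- super-additive branch: Fekete on `−a_K + C`, lower bound `−a_K / K ≥ −6` (K ≥ 1) from `a_K ≤ 3(K+1)`
    have hsub : ∀ m n : ℕ, (fun k : ℕ => -aK k) (m + n) ≤ (fun k : ℕ => -aK k) m + (fun k : ℕ => -aK k) n + C :=
      fun m n => by
        show -aK (m + n) ≤ -aK m + -aK n + C
        linarith [hC m n]
    have hbdd : ∀ n : ℕ, 1 ≤ n → (-6 : ℝ) ≤ (fun k : ℕ => -aK k) n / (n : ℝ) := fun n hn => by
      show (-6 : ℝ) ≤ -aK n / (n : ℝ)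
      have hn' : (1 : ℝ) ≤ (n : ℝ) := by exact_mod_cast hn
      have hnpos : (0 : ℝ) < (n : ℝ) := by linarith
      have hup : aK n ≤ 3 * ((n : ℝ) + 1) := (hW n).2
      rw [neg_div, neg_le_neg_iff, div_le_iff₀ hnpos]
      linarith
    obtain ⟨D, hD⟩ := exists_tendsto_div_of_quasiSubadditive (fun k : ℕ => -aK k) C (-6) hsub hbdd
    refine ⟨-D, ?_⟩
    refine (hD.neg).congr' (Filter.Eventually.of_forall fun n => ?_)
    show -((-aK n) / (n : ℝ)) = aK n / (n : ℝ)
    ring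

/-! ## The kernel-checked composition: stubs ⟹ the crux, BY NAME -/

/-- **COMPOSITION.** `stub_aprioriWindow → stub_quasiAdditive → QuenchedMassExponent` (hypotheses = the
registered stub statements by name, conclusion = the route decl by name; sorry-free). -/
theorem QuenchedMassExponent_of (hW : Registered.stub_aprioriWindow) (hQA : Registered.stub_quasiAdditive) :
    Summit.CriticalPhenomena.Ising3DConformalLimit.Theses.OctantEntropy.QuenchedMassExponent :=
  quenchedMassExponent_iff_aK.mpr (tendsto_div_of_window_of_quasiAdditive hW hQA)

/-- The crux from the registered stubs (closed modulo exactly `stub_aprioriWindow`, `stub_quasiAdditive`). -/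
theorem QuenchedMassExponent_proof : Summit.CriticalPhenomena.Ising3DConformalLimit.Theses.OctantEntropy.QuenchedMassExponent :=
  QuenchedMassExponent_of stub_aprioriWindow stub_quasiAdditive

end Summit.CriticalPhenomena.Ising3DConformalLimit.Cruxes.QuenchedMassExponent.Birth
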